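import Summits.BirchSwinnertonDyer.Rank1Residual.X11b.LevelShiftMaps
import Summits.BirchSwinnertonDyer.Rank1Residual.X11b.KummerTorsionDecomposition
import Literature.NumberTheory.EllipticCurves.SelmerLevelToPrimary
import Literature.NumberTheory.EllipticCurves.PointDivisibilityProofs
import Literature.NumberTheory.EllipticCurves.KummerSelmerStructure
import Literature.NumberTheory.EllipticCurves.SelmerImage
import HarnessLib

/-!
# Route `GenusKolyvaginAtTwo`, crux L_T `PowDvdShaCardAtTwoRT` (stmt-BirchSwinnertonDyer-23242), LINE 18 stub L, bottom rung:
# THE LEVEL MAP `ι : H¹(K, E[p^{K₀}]) → H¹(K, E[p^{K₀+e}])` — RANGE = `p^{K₀}`-TORSION, KUMMER COMPATIBILITY, LOCALISATION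

LEAD seat `bsd-line-gk2-p1` g16 (cell `bsd-f1-sign2`), `--supports 23242 --as helper`.  THEOREMS ONLY; no `sorry`; standard axioms.
BSD is NOT proved by any of this; neither is the crux nor stub L.

WHY (memo `Cruxes/PowDvdShaCardAtTwoRT/Lines/plus-descent-lead-g16.md` §2).  The order-raising auxiliary class of the bottom-rung engine
(`…RTRelaxedCountKummer.exists_mem_solutions_nsmul_ne_zero_canonical`) displays four hypotheses on the level map `ι` between
`H¹_{𝓛,⊤ on T}(K, E[p^{k₂}])` and `H¹_{𝓛,⊤ on T}(K, E[p^{k₄}])`: (hι) injective, (hKO) `ι(H¹_{𝓛,⊤ on T}) ⊆ H¹_{𝓛,⊤ on T}`,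
(htors) every class of `H¹_{𝓛,⊤ on T}` at the upper level killed by `p^{k₂}` is `ι` of a class of `H¹_{𝓛,⊤ on T}` at the lower
level, (hloc0) `loc_u c = 0 ⟹ loc_u (ι c) = 0`.  This file DISCHARGES them for the tree's `ι = torsionH1OfDvd` (`= H¹(levelIncl)`) on a
curve without rational `p`-torsion:
* (htors) = EXACTNESS AT THE UPPER LEVEL of `0 → E[p^{K₀}] → E[p^{K₀+e}] → E[p^e] → 0`, read through `E[p^∞]`: if `p^{K₀}·y = 0` then
  `H¹(ι_{K₀+e}) y` is `p^{K₀}`-torsion in `H¹(K, E[p^∞])`, hence `= H¹(ι_{K₀}) c` (X11b `mem_range_map_primaryInclusion_iff`, divisibility of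
  `E(K̄)`), `= H¹(ι_{K₀+e})(H¹(ι) c)` (`map_primaryInclusion_map_levelIncl`), and `H¹(ι_{K₀+e})` is injective (`E[p^∞]^{Γ_K} = 0` from
  `E(K)[p] = 0`, `map_primaryInclusion_injective`);
* (hKO) and the converse: `torsionH1OfDvd c ∈ H¹_{𝓛,⊤ on T}(p^N) ↔ c ∈ H¹_{𝓛,⊤ on T}(p^d)` (the local Kummer condition is the preimage
  of `ker(H¹(K,E) → H¹(K_v,E))`, level-free: `torsionH1ToH1_torsionH1OfDvd`);
* (hloc0): `loc_v (ι c) = H¹(ι_v)(loc_v c)` (`res_torsionH1OfDvd`);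
* (hι): `torsionH1OfDvd_pow_injective` (tree, `GenusKolyvaginAtTwoVisiblePairAtTwoInjective`) — recalled in the docstrings only.
WHAT (namespace `…Theorems.GenusExact.RelaxedCount`; `H¹(ι)` written `galoisCohomology.map (W.torsionInclusion h) 1`, which is
`torsionH1OfDvd W h` by `map_torsionInclusion_one_apply`): `exists_map_levelIncl_eq_of_nsmul_eq_zero`,
`exists_map_torsionInclusion_eq_of_nsmul_eq_zero`, `res_mem_kummerLocalConditionAt_iff`, `torsionH1OfDvd_mem_selmerLocalKer_iff_mem`,
`map_torsionInclusion_mem_kummerOutside_iff`, `exists_map_torsionInclusion_eq_of_mem_kummerOutside`, `localization_map_torsionInclusion`,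
`localization_map_torsionInclusion_eq_zero`.  Closes nothing.  BSD is NOT proved by any of this.

References: [GreenbergLNM1716] §2 (p. 63), §5 proof of Prop. 5.8; [SilvermanAEC2009] X.§4; [McCallumLMS1991] §4 (5), Lemma 4.6.
-/

set_option autoImplicit false
-- the Theorems namespace of this sub repeats the summit name by design (D-0017 nested layout)
set_option linter.dupNamespace false

noncomputable section

open scoped Classical

open Field NumberField IsDedekindDomain Function WeierstrassCurve
open Literature.NumberTheory.EllipticCurves
open Literature.NumberTheory.GaloisRepresentations
open Summit.BirchSwinnertonDyer.Rank1Residual.X11b.Levels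
open Summit.BirchSwinnertonDyer.Rank1Residual.X11b.LocBridge

universe u

namespace Summit.BirchSwinnertonDyer.BirchSwinnertonDyer.Theorems.GenusExact.RelaxedCount

/-! ## §1 Exactness at the upper level: the `p^{K₀}`-torsion of `H¹(K, E[p^{K₀+e}])` comes from `H¹(K, E[p^{K₀}])` -/

section Range

variable {K : Type u} [Field K] [PerfectField K] (W : WeierstrassCurve K) [W.IsElliptic] (p : ℕ) [Fact p.Prime]

/-- **`H¹(K, E[p^{K₀+e}])[p^{K₀}] = H¹(ι)(H¹(K, E[p^{K₀}]))` when `E(K)[p] = 0`** (exactness of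
`H¹(K,E[p^{K₀}]) → H¹(K,E[p^{K₀+e}]) → H¹(K,E[p^e])` at the middle term, read through `E[p^∞]`: the image of `y` in `H¹(K, E[p^∞])` is
`p^{K₀}`-torsion, hence comes from level `p^{K₀}` (`mem_range_map_primaryInclusion_iff`), and `H¹(K,E[p^{K₀+e}]) → H¹(K,E[p^∞])` is
injective because `E[p^∞]^{Γ_K} = 0`). [cite: GreenbergLNM1716, §2 p. 63 and §5 proof of Prop. 5.8] -/
theorem exists_map_levelIncl_eq_of_nsmul_eq_zero (hK : AddSubgroup.torsionBy W.toAffine.Point (p : ℤ) = ⊥) (K₀ e : ℕ)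
    (y : galoisCohomology (W.torsionGaloisModule ((p ^ (K₀ + e) : ℕ) : ℤ)) 1) (hy : p ^ K₀ • y = 0) :
    ∃ c : galoisCohomology (W.torsionGaloisModule ((p ^ K₀ : ℕ) : ℤ)) 1, galoisCohomology.map (levelIncl W p K₀ e) 1 c = y := by
  have hΓ : ∀ Q : W.geomPrimaryTorsion p, (∀ σ : absoluteGaloisGroup K, primaryGaloisModule W p σ Q = Q) → Q = 0 :=
    fun Q hQ ↦ W.geomPrimaryTorsion_eq_zero_of_forall_smul_eq p hK Q fun σ ↦ hQ σ
  have hinj := map_primaryInclusion_injective W p (K₀ + e) hΓ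
  set z := galoisCohomology.map (primaryInclusion W p (K₀ + e)) 1 y with hz
  have hz0 : p ^ K₀ • z = 0 := by rw [hz, ← map_nsmul, hy, map_zero]
  obtain ⟨c, hc⟩ := (mem_range_map_primaryInclusion_iff W p K₀ W.zsmul_geomPoints_surjective_holds z).mpr hz0
  refine ⟨c, hinj ?_⟩
  rw [map_primaryInclusion_map_levelIncl, hc]

/-- The same for `H¹(torsionInclusion h)` with ANY proof `h` of `p^{K₀} ∣ p^{K₀+e}` (`levelIncl` is `torsionInclusion` of one such proof;
`H¹(torsionInclusion h) c = torsionH1OfDvd W h c` is `map_torsionInclusion_one_apply`). [cite: GreenbergLNM1716, §5 proof of Prop. 5.8] -/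
theorem exists_map_torsionInclusion_eq_of_nsmul_eq_zero (hK : AddSubgroup.torsionBy W.toAffine.Point (p : ℤ) = ⊥) (K₀ e : ℕ)
    (h : ((p ^ K₀ : ℕ) : ℤ) ∣ ((p ^ (K₀ + e) : ℕ) : ℤ))
    (y : galoisCohomology (W.torsionGaloisModule ((p ^ (K₀ + e) : ℕ) : ℤ)) 1) (hy : p ^ K₀ • y = 0) :
    ∃ c : galoisCohomology (W.torsionGaloisModule ((p ^ K₀ : ℕ) : ℤ)) 1, galoisCohomology.map (W.torsionInclusion h) 1 c = y :=
  exists_map_levelIncl_eq_of_nsmul_eq_zero W p hK K₀ e y hy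

end Range

/-! ## §2 `H¹_{𝓛, ⊤ on T}` is level-stable under `ι`, in both directions -/

section Kummer

variable {K : Type} [Field K] [NumberField K] (W : WeierstrassCurve K)

omit [NumberField K] in
/-- The local Kummer condition through `res`, as membership: `res_E x ∈ 𝓛_E ↔ x ∈ selmerLocalKer W E n`. [folklore] -/
theorem res_mem_kummerLocalConditionAt_iff (n : ℤ) (E : Type) [Field E] [Algebra K E] (x : galH1Torsion W n) :
    galoisCohomology.res (W.torsionGaloisModule n) E 1 x ∈ W.kummerLocalConditionAt n E ↔ x ∈ selmerLocalKer W E n := by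
  rw [← comap_res_kummerLocalConditionAt]
  exact Iff.rfl

omit [NumberField K] in
/-- The local Selmer kernel is level-stable: `ι c ∈ selmerLocalKer W E N ↔ c ∈ selmerLocalKer W E d` (both are preimages of
`ker(H¹(K,E) → H¹(E,E))`, and `H¹(K,E[d]) → H¹(K,E[N]) → H¹(K,E)` is `H¹(K,E[d]) → H¹(K,E)`; the two-line proof of the `LocPKummer` /
`VisiblePairAtTwo` files, restated here to keep the imports light). [cite: SilvermanAEC2009, X.§4] -/
theorem torsionH1OfDvd_mem_selmerLocalKer_iff_mem {d N : ℤ} (h : d ∣ N) (E : Type) [Field E] [Algebra K E]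
    (c : galH1Torsion W d) :
    torsionH1OfDvd W h c ∈ selmerLocalKer W E N ↔ c ∈ selmerLocalKer W E d := by
  rw [WeierstrassCurve.selmerLocalKer_eq_comap, WeierstrassCurve.selmerLocalKer_eq_comap, AddSubgroup.mem_comap,
    AddSubgroup.mem_comap, torsionH1ToH1_torsionH1OfDvd]

/-- **`H¹(ι) c ∈ H¹_{𝓛,⊤ on T}(K, E[N]) ↔ c ∈ H¹_{𝓛,⊤ on T}(K, E[d])`** (`d ∣ N`; `H¹(ι) = torsionH1OfDvd`, `map_torsionInclusion_one_apply`):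
at every place the local Kummer condition is the preimage of `ker(H¹(K, E) → H¹(K_v, E))`, which does not see the level.
[cite: SilvermanAEC2009, X.§4] -/
theorem map_torsionInclusion_mem_kummerOutside_iff {d N : ℕ} (h : (d : ℤ) ∣ (N : ℤ)) (T : Finset (Place K))
    (c : galoisCohomology (W.torsionGaloisModule (d : ℤ)) 1) :
    galoisCohomology.map (W.torsionInclusion h) 1 c ∈ kummerOutside W N T ↔ c ∈ kummerOutside W d T := by
  rw [mem_kummerOutside_iff, mem_kummerOutside_iff]
  refine forall_congr' fun v ↦ forall_congr' fun _ ↦ ?_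
  exact (res_mem_kummerLocalConditionAt_iff W (N : ℤ) (Place.Completion v) (torsionH1OfDvd W h c)).trans
    ((torsionH1OfDvd_mem_selmerLocalKer_iff_mem W h (Place.Completion v) c).trans
      (res_mem_kummerLocalConditionAt_iff W (d : ℤ) (Place.Completion v) c).symm)

/-- **(htors) of the bottom-rung engine**: on a curve without rational `p`-torsion, every class of `H¹_{𝓛,⊤ on T}(K, E[p^{K₀+e}])`
killed by `p^{K₀}` is `H¹(ι)` of a class of `H¹_{𝓛,⊤ on T}(K, E[p^{K₀}])`. [cite: GreenbergLNM1716, §5 proof of Prop. 5.8]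
[cite: SilvermanAEC2009, X.§4] -/
theorem exists_map_torsionInclusion_eq_of_mem_kummerOutside [W.IsElliptic] (p : ℕ) [Fact p.Prime]
    (hK : AddSubgroup.torsionBy W.toAffine.Point (p : ℤ) = ⊥) (K₀ e : ℕ) (h : ((p ^ K₀ : ℕ) : ℤ) ∣ ((p ^ (K₀ + e) : ℕ) : ℤ))
    (T : Finset (Place K)) (y : galoisCohomology (W.torsionGaloisModule ((p ^ (K₀ + e) : ℕ) : ℤ)) 1)
    (hyT : y ∈ kummerOutside W (p ^ (K₀ + e)) T) (hy : p ^ K₀ • y = 0) :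
    ∃ c ∈ kummerOutside W (p ^ K₀) T, galoisCohomology.map (W.torsionInclusion h) 1 c = y := by
  haveI : PerfectField K := PerfectField.ofCharZero
  obtain ⟨c, rfl⟩ := exists_map_levelIncl_eq_of_nsmul_eq_zero W p hK K₀ e y hy
  exact ⟨c, (map_torsionInclusion_mem_kummerOutside_iff W h T c).mp hyT, rfl⟩

/-! ## §3 Localisation commutes with `ι` -/

/-- **`loc_v (H¹(ι) c) = H¹(ι_v) (loc_v c)`** (restriction to the completion commutes with the change of coefficients).
[cite: SerreGaloisCohomology1997, I §2.4] -/
theorem localization_map_torsionInclusion {d N : ℤ} (h : d ∣ N) (v : Place K)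
    (c : galoisCohomology (W.torsionGaloisModule d) 1) :
    galoisCohomology.localization (W.torsionGaloisModule N) v 1 (galoisCohomology.map (W.torsionInclusion h) 1 c) =
      galoisCohomology.map ((W.torsionInclusion h).restrictField (Place.Completion v)) 1
        (galoisCohomology.localization (W.torsionGaloisModule d) v 1 c) :=
  Summit.BirchSwinnertonDyer.Rank1Residual.X11b.KummerDecomp.res_torsionH1OfDvd W N (Place.Completion v) h c

/-- **(hloc0) of the bottom-rung engine**: `loc_v c = 0 ⟹ loc_v (H¹(ι) c) = 0`. [cite: SerreGaloisCohomology1997, I §2.4] -/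
theorem localization_map_torsionInclusion_eq_zero {d N : ℤ} (h : d ∣ N) (v : Place K)
    (c : galoisCohomology (W.torsionGaloisModule d) 1)
    (hc : galoisCohomology.localization (W.torsionGaloisModule d) v 1 c = 0) :
    galoisCohomology.localization (W.torsionGaloisModule N) v 1 (galoisCohomology.map (W.torsionInclusion h) 1 c) = 0 := by
  rw [localization_map_torsionInclusion, hc]
  exact map_zero _

end Kummer

end Summit.BirchSwinnertonDyer.BirchSwinnertonDyer.Theorems.GenusExact.RelaxedCount

end
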